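import Summits.QuantumFields.QCD.Theorems.PauliWegnerSeaPhaseQuenchedFlavourDecayEntryMomentFinal
import Summits.QuantumFields.QCD.Theorems.PauliWegnerSeaPhaseQuenchedFlavourDecayJacobiComplementaryMinor
import Summits.QuantumFields.QCD.Theorems.PauliWegnerSeaPhaseQuenchedFlavourDecayGramOfColumns
import Summits.QuantumFields.QCD.Theorems.PauliWegnerSeaPhaseQuenchedFlavourDecayGramMomentIntegrableMixed

/-!
# The integrability conjunct of the open core `stub_gramMomentsCore` for its literal quantifier — unconditional form
(crux stmt-QuantumFields-9151 `PauliWegnerSea.PhaseQuenchedFlavourDecay`, line `crossing-split-integrability`, lead c4)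

Assembly only: `stub_gramMomentIntegrableMixedOf` (`…GramMomentIntegrableMixed`) applied to the landed inputs
`stub_wilsonDetNegMoment`, `stub_jacobiComplementaryMinor`, `stub_gramOfColumns_det_ne_zero`.  Result (registered stub
`stub_gramMomentIntegrableMixed`): there is `s₀ > 0` (independent of everything) such that for every `N_f` and every
`1/2 < q < 1/2 + s₀/(2(N_f+1))`, on every torus of side `≥ 4`, for every `β`, mass vector, `r` and `I : Fin r → QuarkVar N_f`,
the core's integrand `(Re det((G Gᴴ)[I,I]))^q` is integrable under the phase-quenched measure `qcdLatticeMeasure`.  With this the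
`Integrable` conjunct of `GramMoments` (Signature A of the promoted item) is DISCHARGED at every `(k, S)` for `q` in that window;
the open content of the core is the uniform bound.
-/

noncomputable section

namespace Summit.QuantumFields.QCD.Cruxes.PhaseQuenchedFlavourDecay.CrossingSplitIntegrability

open MeasureTheory
open Literature.MathematicalPhysics.QuantumFieldTheory Literature.MathematicalPhysics.QuantumLattice
  Literature.Probability.LatticeModels

/-- **stub `stub_gramMomentIntegrableMixed` (registered additive stub of crux stmt-QuantumFields-9151)** — the integrability
conjunct of the open core for its literal quantifier, unconditionally:
`∃ s₀ > 0, ∀ N_f, ∀ q ∈ (1/2, 1/2 + s₀/(2(N_f+1))), ∀ L ≥ 4, β, mq, r, I : Fin r → QuarkVar N_f L,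
Integrable ((Re det((GGᴴ)[I,I]))^q) (qcdLatticeMeasure L β mq)`. -/
theorem stub_gramMomentIntegrableMixed :
    ∃ s₀ : ℝ, 0 < s₀ ∧ ∀ (Nf : ℕ) (q : ℝ), 1 / 2 < q → q < 1 / 2 + s₀ / (2 * ((Nf : ℝ) + 1)) →
      ∀ (L : ℕ) [NeZero L], 4 ≤ L → ∀ (β : ℝ) (mq : Fin Nf → ℝ) (r : ℕ) (I : Fin r → QuarkVar Nf L),
        MeasureTheory.Integrable (fun U : GaugeConfig 4 L SU3 =>
          (Matrix.of fun a b : Fin r =>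
            ((diracMatrix U mq)⁻¹ * ((diracMatrix U mq)⁻¹).conjTranspose)
              (quarkEquiv (I a)) (quarkEquiv (I b))).det.re ^ q) (qcdLatticeMeasure L β mq) :=
  stub_gramMomentIntegrableMixedOf stub_wilsonDetNegMoment stub_jacobiComplementaryMinor stub_gramOfColumns_det_ne_zero

end Summit.QuantumFields.QCD.Cruxes.PhaseQuenchedFlavourDecay.CrossingSplitIntegrability

end
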